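import Literature.MathematicalPhysics.QuantumManyBody.PeriodicFeynmanKacOperator
import Literature.MathematicalPhysics.QuantumManyBody.PeriodicFeynmanKacSymmetry
import Mathlib.Analysis.InnerProductSpace.Adjoint
import Mathlib.MeasureTheory.Function.LpOrder
import HarnessLib

/-!
# Periodic Feynman–Kac: self-adjointness, semigroup law and positivity of `e^{-tH}` on `L²(cell)`

Topic `Literature/MathematicalPhysics/QuantumManyBody`; theorems only. Step of the proof of the
named fact `Literature.MathematicalPhysics.QuantumManyBody.BoseGas.PeriodicGroundStateFeynmanKac`
(`PeriodicHeatFlowSpectral.lean`); torus twin of `GroundStateFeynmanKacOperatorProps.lean`: the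
operator-level properties of `pfkL2 v L t` (`PeriodicFeynmanKacOperator.lean`) on the real Hilbert
space `L²([0,L)^{3N})` behind the Perron–Frobenius argument (Chung–Zhao (1995), Thm 3.10: the
Feynman–Kac semigroup (26) of a symmetric Hunt process — the Brownian motion of the flat torus —
is a semigroup of positive, symmetric contractions on `L²(S, m)`; Reed–Simon IV §XIII.12):

* `setIntegral_cellN_mul_pfkReal_comm` — `∫_cell g · e^{-tH} f = ∫_cell f · e^{-tH} g` for real
  periodic `f, g ∈ L²(cell)` (from the path-space symmetry on the cell,
  `setLIntegral_cellN_mul_periodicFKSemigroup_comm`, by splitting into positive and negative parts),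
  `inner_pfkL2_comm`, `isSelfAdjoint_pfkL2`;
* `pfkReal_add_time`, `pfkL2_add_time` — `e^{-(s+t)H} = e^{-sH} e^{-tH}` (`s, t > 0`) from
  `periodicFKSemigroup_add`;
* `pfkL2_nonneg`, `abs_pfkL2_le` — positivity preservation `f ≥ 0 ⇒ e^{-tH} f ≥ 0` and
  `|e^{-tH} f| ≤ e^{-tH} |f|`;
* `inner_pfkL2_self_nonneg` — `⟪e^{-tH} g, g⟫ = ‖e^{-tH/2} g‖² ≥ 0`.

## References

* K. L. Chung, Z. Zhao, *From Brownian Motion to Schrödinger's Equation* (1995), §3.2 (26),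
  Thm 3.10. [ChungZhao1995]
* M. Reed, B. Simon, *Methods of Modern Mathematical Physics IV* (1978), §XIII.12.
-/

noncomputable section

namespace Literature.MathematicalPhysics.QuantumManyBody.BoseGas

open MeasureTheory ProbabilityTheory Filter Set
open scoped ENNReal NNReal Topology InnerProductSpace
open Literature.Probability.Process

variable {N : ℕ}

/-! ### Positive and negative parts of a periodic real observable -/

/-- The positive part `f⁺ = max f 0` has no more `L²(cell)` mass than `f`. [folklore] -/
theorem setLIntegral_cellN_enorm_posPart_sq_ne_top (L : ℝ) {f : Config N → ℝ}
    (hf2 : ∫⁻ Y in cellN N L, ‖f Y‖ₑ ^ (2 : ℝ) ≠ ⊤) :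
    ∫⁻ Y in cellN N L, ‖max (f Y) 0‖ₑ ^ (2 : ℝ) ≠ ⊤ := by
  refine ne_top_of_le_ne_top hf2 (lintegral_mono fun Y => ?_)
  refine ENNReal.rpow_le_rpow ?_ (by norm_num)
  rw [Real.enorm_of_nonneg (le_max_right _ _), Real.enorm_eq_ofReal_abs]
  exact ENNReal.ofReal_le_ofReal (max_le (le_abs_self _) (abs_nonneg _))

/-- The negative part `f⁻ = max (-f) 0` has no more `L²(cell)` mass than `f`. [folklore] -/
theorem setLIntegral_cellN_enorm_negPart_sq_ne_top (L : ℝ) {f : Config N → ℝ}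
    (hf2 : ∫⁻ Y in cellN N L, ‖f Y‖ₑ ^ (2 : ℝ) ≠ ⊤) :
    ∫⁻ Y in cellN N L, ‖max (-f Y) 0‖ₑ ^ (2 : ℝ) ≠ ⊤ := by
  have h : ∫⁻ Y in cellN N L, ‖(-f) Y‖ₑ ^ (2 : ℝ) ≠ ⊤ := by simpa using hf2
  exact setLIntegral_cellN_enorm_posPart_sq_ne_top L h

/-- The positive part of a periodic function is periodic. [folklore] -/
theorem posPart_periodic {L : ℝ} {f : Config N → ℝ}
    (hper : ∀ (Y : Config N) (i : Fin N) (k : Fin 3),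
      f (Y + Pi.single i (EuclideanSpace.single k L)) = f Y)
    (Y : Config N) (i : Fin N) (k : Fin 3) :
    max (f (Y + Pi.single i (EuclideanSpace.single k L))) 0 = max (f Y) 0 := by
  rw [hper]

/-- The negative part of a periodic function is periodic. [folklore] -/
theorem negPart_periodic {L : ℝ} {f : Config N → ℝ}
    (hper : ∀ (Y : Config N) (i : Fin N) (k : Fin 3),
      f (Y + Pi.single i (EuclideanSpace.single k L)) = f Y)
    (Y : Config N) (i : Fin N) (k : Fin 3) :
    max (-f (Y + Pi.single i (EuclideanSpace.single k L))) 0 = max (-f Y) 0 := by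
  rw [hper]

/-- `f = f⁺ - f⁻` for real functions on configuration space (pointwise `max`). [folklore] -/
theorem posPart_sub_negPart_config (f : Config N → ℝ) :
    (fun Y => max (f Y) 0) - (fun Y => max (-f Y) 0) = f := by
  funext Y
  simp only [Pi.sub_apply]
  exact max_zero_sub_max_neg_zero_eq_self (f Y)

/-- **Linearity over the decomposition `f = f⁺ - f⁻`**: `e^{-tH} f = e^{-tH} f⁺ - e^{-tH} f⁻`
(`t > 0`, periodic `f ∈ L²(cell)`). [folklore] -/
theorem pfkReal_eq_posPart_sub_negPart {v : ℝ → ℝ≥0∞} (hv : Measurable v) {L : ℝ} (hL : 0 < L)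
    {t : ℝ} (ht : 0 < t) {f : Config N → ℝ} (hf : Measurable f)
    (hper : ∀ (Y : Config N) (i : Fin N) (k : Fin 3),
      f (Y + Pi.single i (EuclideanSpace.single k L)) = f Y)
    (hf2 : ∫⁻ Y in cellN N L, ‖f Y‖ₑ ^ (2 : ℝ) ≠ ⊤) (X : Config N) :
    pfkReal v L t f X = pfkReal v L t (fun Y => max (f Y) 0) X -
      pfkReal v L t (fun Y => max (-f Y) 0) X := by
  have hp : Measurable fun Y => max (f Y) 0 := hf.max measurable_const
  have hn : Measurable fun Y => max (-f Y) 0 := hf.neg.max measurable_const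
  conv_lhs => rw [← posPart_sub_negPart_config f]
  rw [sub_eq_add_neg, pfkReal_add hv hL ht hp hn.neg (posPart_periodic hper)
    (fun Y i k => by simp only [Pi.neg_apply, negPart_periodic hper])
    (setLIntegral_cellN_enorm_posPart_sq_ne_top L hf2)
    (by simpa using setLIntegral_cellN_enorm_negPart_sq_ne_top L hf2) X]
  rw [show (-fun Y => max (-f Y) 0) = (-1 : ℝ) • fun Y => max (-f Y) 0 by simp, pfkReal_smul]
  ring

/-! ### Symmetry on `L²(cell)` -/

/-- The product of a periodic `L²(cell)` observable with the transform of another is integrable on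
the cell. [folklore] -/
theorem integrable_mul_pfkReal {v : ℝ → ℝ≥0∞} (hv : Measurable v) {L : ℝ} (hL : 0 < L) (t : ℝ)
    {f g : Config N → ℝ} (hf : Measurable f) (hg : Measurable g)
    (hfper : ∀ (Y : Config N) (i : Fin N) (k : Fin 3),
      f (Y + Pi.single i (EuclideanSpace.single k L)) = f Y)
    (hf2 : ∫⁻ Y in cellN N L, ‖f Y‖ₑ ^ (2 : ℝ) ≠ ⊤) (hg2 : ∫⁻ Y in cellN N L, ‖g Y‖ₑ ^ (2 : ℝ) ≠ ⊤) :
    Integrable (fun X => g X * pfkReal v L t f X) (volume.restrict (cellN N L)) := by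
  have hgm : MemLp g 2 (volume.restrict (cellN N L)) := by
    refine ⟨hg.aestronglyMeasurable, ?_⟩
    rw [eLpNorm_two_eq_cellN]
    exact ENNReal.rpow_lt_top_of_nonneg (by norm_num) hg2
  have hRm : MemLp (pfkReal v L t f) 2 (volume.restrict (cellN N L)) := by
    refine ⟨(measurable_pfkReal hv L t hf).aestronglyMeasurable, ?_⟩
    rw [eLpNorm_two_eq_cellN]
    refine ENNReal.rpow_lt_top_of_nonneg (by norm_num) (ne_top_of_le_ne_top hf2 ?_)
    exact setLIntegral_cellN_enorm_pfkReal_sq_le hv hL t hf hfper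
  exact hgm.integrable_mul hRm

/-- **Symmetry for nonnegative periodic observables**: `∫_cell g · e^{-tH} f = ∫_cell f · e^{-tH} g`
for measurable periodic `f, g ≥ 0` in `L²(cell)`, `t > 0` (the path-space symmetry on the cell,
`setLIntegral_cellN_mul_periodicFKSemigroup_comm`, read in `ℝ`). [folklore] -/
theorem setIntegral_cellN_mul_pfkReal_comm_of_nonneg {v : ℝ → ℝ≥0∞} (hv : Measurable v) {L : ℝ}
    (hL : 0 < L) {t : ℝ} (ht : 0 < t) {f g : Config N → ℝ} (hf : Measurable f) (hg : Measurable g)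
    (hf0 : ∀ Y, 0 ≤ f Y) (hg0 : ∀ Y, 0 ≤ g Y)
    (hfper : ∀ (Y : Config N) (i : Fin N) (k : Fin 3),
      f (Y + Pi.single i (EuclideanSpace.single k L)) = f Y)
    (hgper : ∀ (Y : Config N) (i : Fin N) (k : Fin 3),
      g (Y + Pi.single i (EuclideanSpace.single k L)) = g Y)
    (hf2 : ∫⁻ Y in cellN N L, ‖f Y‖ₑ ^ (2 : ℝ) ≠ ⊤) (hg2 : ∫⁻ Y in cellN N L, ‖g Y‖ₑ ^ (2 : ℝ) ≠ ⊤) :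
    ∫ X in cellN N L, g X * pfkReal v L t f X = ∫ X in cellN N L, f X * pfkReal v L t g X := by
  -- both sides as `toReal` of `[0, ∞]`-integrals
  have key : ∀ {a b : Config N → ℝ}, Measurable a → Measurable b → (∀ Y, 0 ≤ a Y) →
      (∀ Y, 0 ≤ b Y) →
      (∀ (Y : Config N) (i : Fin N) (k : Fin 3),
        a (Y + Pi.single i (EuclideanSpace.single k L)) = a Y) →
      ∫⁻ Y in cellN N L, ‖a Y‖ₑ ^ (2 : ℝ) ≠ ⊤ →
      ∫ X in cellN N L, b X * pfkReal v L t a X =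
        (∫⁻ X in cellN N L, ENNReal.ofReal (b X) *
          periodicFKSemigroup v L t (fun Y => ENNReal.ofReal (a Y)) X).toReal := by
    intro a b ha hb ha0 hb0 haper ha2
    rw [integral_eq_lintegral_of_nonneg_ae (Eventually.of_forall fun X =>
        mul_nonneg (hb0 X) (pfkReal_nonneg v L t ha0 X))
      ((hb.mul (measurable_pfkReal hv L t ha)).aestronglyMeasurable)]
    congr 1
    refine lintegral_congr fun X => ?_
    rw [ENNReal.ofReal_mul (hb0 X), pfkReal_eq_toReal_periodicFKSemigroup hv L t ha ha0,
      ENNReal.ofReal_toReal]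
    refine (periodicFKSemigroup_lt_top_of_cell v hL ht ha.ennreal_ofReal
      (fun Y i k => by rw [haper]) ?_ X).ne
    convert ha2 using 1
    refine lintegral_congr fun Y => ?_
    rw [Real.enorm_of_nonneg (ha0 Y)]
  rw [key hf hg hf0 hg0 hfper hf2, key hg hf hg0 hf0 hgper hg2,
    setLIntegral_cellN_mul_periodicFKSemigroup_comm hv hL ht.le hg.ennreal_ofReal hf.ennreal_ofReal
      (fun Y i k => by rw [hgper]) (fun Y i k => by rw [hfper])]

/-- **Symmetry of `e^{-tH}` on `L²([0,L)^{3N})`**: `∫_cell g · e^{-tH} f = ∫_cell f · e^{-tH} g` for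
real measurable periodic `f, g` square integrable on the cell, `t > 0` (positive/negative parts and
bilinearity). Chung–Zhao (1995), Thm 3.10 (symmetric density `u_t`). [cite: ChungZhao1995, Thm 3.10] -/
theorem setIntegral_cellN_mul_pfkReal_comm {v : ℝ → ℝ≥0∞} (hv : Measurable v) {L : ℝ} (hL : 0 < L)
    {t : ℝ} (ht : 0 < t) {f g : Config N → ℝ} (hf : Measurable f) (hg : Measurable g)
    (hfper : ∀ (Y : Config N) (i : Fin N) (k : Fin 3),
      f (Y + Pi.single i (EuclideanSpace.single k L)) = f Y)
    (hgper : ∀ (Y : Config N) (i : Fin N) (k : Fin 3),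
      g (Y + Pi.single i (EuclideanSpace.single k L)) = g Y)
    (hf2 : ∫⁻ Y in cellN N L, ‖f Y‖ₑ ^ (2 : ℝ) ≠ ⊤) (hg2 : ∫⁻ Y in cellN N L, ‖g Y‖ₑ ^ (2 : ℝ) ≠ ⊤) :
    ∫ X in cellN N L, g X * pfkReal v L t f X = ∫ X in cellN N L, f X * pfkReal v L t g X := by
  -- the four parts
  set fp : Config N → ℝ := fun Y => max (f Y) 0 with hfp
  set fn : Config N → ℝ := fun Y => max (-f Y) 0 with hfn
  set gp : Config N → ℝ := fun Y => max (g Y) 0 with hgp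
  set gn : Config N → ℝ := fun Y => max (-g Y) 0 with hgn
  have mfp : Measurable fp := hf.max measurable_const
  have mfn : Measurable fn := hf.neg.max measurable_const
  have mgp : Measurable gp := hg.max measurable_const
  have mgn : Measurable gn := hg.neg.max measurable_const
  have pfp : ∀ (Y : Config N) (i : Fin N) (k : Fin 3),
      fp (Y + Pi.single i (EuclideanSpace.single k L)) = fp Y := posPart_periodic hfper
  have pfn : ∀ (Y : Config N) (i : Fin N) (k : Fin 3),
      fn (Y + Pi.single i (EuclideanSpace.single k L)) = fn Y := negPart_periodic hfper
  have pgp : ∀ (Y : Config N) (i : Fin N) (k : Fin 3),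
      gp (Y + Pi.single i (EuclideanSpace.single k L)) = gp Y := posPart_periodic hgper
  have pgn : ∀ (Y : Config N) (i : Fin N) (k : Fin 3),
      gn (Y + Pi.single i (EuclideanSpace.single k L)) = gn Y := negPart_periodic hgper
  have ifp := setLIntegral_cellN_enorm_posPart_sq_ne_top L hf2
  have ifn := setLIntegral_cellN_enorm_negPart_sq_ne_top L hf2
  have igp := setLIntegral_cellN_enorm_posPart_sq_ne_top L hg2
  have ign := setLIntegral_cellN_enorm_negPart_sq_ne_top L hg2
  have p0 : ∀ (h : Config N → ℝ) (Y : Config N), 0 ≤ max (h Y) 0 := fun h Y => le_max_right _ _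
  -- expand both sides
  have hLft : ∀ X, g X * pfkReal v L t f X =
      (gp X * pfkReal v L t fp X - gp X * pfkReal v L t fn X) -
        (gn X * pfkReal v L t fp X - gn X * pfkReal v L t fn X) := by
    intro X
    rw [pfkReal_eq_posPart_sub_negPart hv hL ht hf hfper hf2 X]
    have hg' : g X = gp X - gn X := (max_zero_sub_max_neg_zero_eq_self (g X)).symm
    rw [hg']
    ring
  have hRgt : ∀ X, f X * pfkReal v L t g X =
      (fp X * pfkReal v L t gp X - fp X * pfkReal v L t gn X) -
        (fn X * pfkReal v L t gp X - fn X * pfkReal v L t gn X) := by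
    intro X
    rw [pfkReal_eq_posPart_sub_negPart hv hL ht hg hgper hg2 X]
    have hf' : f X = fp X - fn X := (max_zero_sub_max_neg_zero_eq_self (f X)).symm
    rw [hf']
    ring
  simp_rw [hLft, hRgt]
  have I := fun {a b : Config N → ℝ} (ha : Measurable a) (hb : Measurable b)
    (haper : ∀ (Y : Config N) (i : Fin N) (k : Fin 3),
      a (Y + Pi.single i (EuclideanSpace.single k L)) = a Y)
    (ha2 : ∫⁻ Y in cellN N L, ‖a Y‖ₑ ^ (2 : ℝ) ≠ ⊤) (hb2 : ∫⁻ Y in cellN N L, ‖b Y‖ₑ ^ (2 : ℝ) ≠ ⊤) =>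
    integrable_mul_pfkReal hv hL t ha hb haper ha2 hb2
  have HL1 : Integrable (fun X => gp X * pfkReal v L t fp X - gp X * pfkReal v L t fn X)
      (volume.restrict (cellN N L)) := (I mfp mgp pfp ifp igp).sub (I mfn mgp pfn ifn igp)
  have HL2 : Integrable (fun X => gn X * pfkReal v L t fp X - gn X * pfkReal v L t fn X)
      (volume.restrict (cellN N L)) := (I mfp mgn pfp ifp ign).sub (I mfn mgn pfn ifn ign)
  have HR1 : Integrable (fun X => fp X * pfkReal v L t gp X - fp X * pfkReal v L t gn X)
      (volume.restrict (cellN N L)) := (I mgp mfp pgp igp ifp).sub (I mgn mfp pgn ign ifp)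
  have HR2 : Integrable (fun X => fn X * pfkReal v L t gp X - fn X * pfkReal v L t gn X)
      (volume.restrict (cellN N L)) := (I mgp mfn pgp igp ifn).sub (I mgn mfn pgn ign ifn)
  rw [integral_sub HL1 HL2, integral_sub (I mfp mgp pfp ifp igp) (I mfn mgp pfn ifn igp),
    integral_sub (I mfp mgn pfp ifp ign) (I mfn mgn pfn ifn ign),
    integral_sub HR1 HR2, integral_sub (I mgp mfp pgp igp ifp) (I mgn mfp pgn ign ifp),
    integral_sub (I mgp mfn pgp igp ifn) (I mgn mfn pgn ign ifn),
    setIntegral_cellN_mul_pfkReal_comm_of_nonneg hv hL ht mfp mgp (p0 f) (p0 g) pfp pgp ifp igp,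
    setIntegral_cellN_mul_pfkReal_comm_of_nonneg hv hL ht mfn mgp (p0 _) (p0 g) pfn pgp ifn igp,
    setIntegral_cellN_mul_pfkReal_comm_of_nonneg hv hL ht mfp mgn (p0 f) (p0 _) pfp pgn ifp ign,
    setIntegral_cellN_mul_pfkReal_comm_of_nonneg hv hL ht mfn mgn (p0 _) (p0 _) pfn pgn ifn ign]
  ring

/-- **`⟪e^{-tH} f, g⟫ = ⟪f, e^{-tH} g⟫` on `L²([0,L)^{3N})`** (`t > 0`, `L > 0`, measurable `v`).
[folklore] -/
theorem inner_pfkL2_comm {v : ℝ → ℝ≥0∞} (hv : Measurable v) {L : ℝ} (hL : 0 < L) {t : ℝ}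
    (ht : 0 < t) (f g : Lp ℝ 2 (volume.restrict (cellN N L))) :
    ⟪pfkL2 v L t f, g⟫_ℝ = ⟪f, pfkL2 v L t g⟫_ℝ := by
  rw [L2.inner_def, L2.inner_def]
  -- replace the representatives by their periodic extensions (equal on the cell)
  have hf' := comp_cellProj_ae_eq_restrict hL (f : Config N → ℝ)
  have hg' := comp_cellProj_ae_eq_restrict hL (g : Config N → ℝ)
  have h1 : ∫ X, ⟪(pfkL2 v L t f : Config N → ℝ) X, g X⟫_ℝ ∂volume.restrict (cellN N L) =
      ∫ X in cellN N L, (⇑g ∘ cellProj L) X * pfkReal v L t (⇑f ∘ cellProj L) X := by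
    refine integral_congr_ae ?_
    filter_upwards [pfkL2_coeFn hv hL ht f, hg'] with X hX hgX
    rw [hX, RCLike.inner_apply, conj_trivial, hgX]
  have h2 : ∫ X, ⟪(f : Config N → ℝ) X, (pfkL2 v L t g : Config N → ℝ) X⟫_ℝ
      ∂volume.restrict (cellN N L) =
      ∫ X in cellN N L, (⇑f ∘ cellProj L) X * pfkReal v L t (⇑g ∘ cellProj L) X := by
    refine integral_congr_ae ?_
    filter_upwards [pfkL2_coeFn hv hL ht g, hf'] with X hX hfX
    rw [hX, RCLike.inner_apply, conj_trivial, mul_comm, hfX]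
  rw [h1, h2]
  exact setIntegral_cellN_mul_pfkReal_comm hv hL ht
    ((measurable_coeFn_Lp_cellN f).comp (measurable_cellProj L))
    ((measurable_coeFn_Lp_cellN g).comp (measurable_cellProj L))
    (comp_cellProj_periodic hL.ne' _) (comp_cellProj_periodic hL.ne' _)
    (setLIntegral_cellN_enorm_comp_cellProj_sq_ne_top hL f)
    (setLIntegral_cellN_enorm_comp_cellProj_sq_ne_top hL g)

/-- **`e^{-tH_N^per}` is self-adjoint on `L²([0,L)^{3N})`** (`t > 0`, `L > 0`, measurable `v`).
Chung–Zhao (1995), Thm 3.10 (symmetry of the Feynman–Kac semigroup on `L²(S, m)`).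
[cite: ChungZhao1995, Thm 3.10] -/
theorem isSelfAdjoint_pfkL2 {v : ℝ → ℝ≥0∞} (hv : Measurable v) {L : ℝ} (hL : 0 < L) {t : ℝ}
    (ht : 0 < t) :
    IsSelfAdjoint (pfkL2 v L t :
      Lp ℝ 2 (volume.restrict (cellN N L)) →L[ℝ] Lp ℝ 2 (volume.restrict (cellN N L))) := by
  rw [ContinuousLinearMap.isSelfAdjoint_iff_isSymmetric]
  intro f g
  exact inner_pfkL2_comm hv hL ht f g

/-! ### The semigroup law on `L²(cell)` -/

/-- **`e^{-(s+t)H} a = e^{-sH} (e^{-tH} a)` for nonnegative periodic `a ∈ L²(cell)`**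
(`s, t > 0`), from the semigroup law of the `[0, ∞]`-valued functional. [folklore] -/
theorem pfkReal_add_time_of_nonneg {v : ℝ → ℝ≥0∞} (hv : Measurable v) {L : ℝ} (hL : 0 < L)
    {s t : ℝ} (hs : 0 < s) (ht : 0 < t) {a : Config N → ℝ} (ha : Measurable a) (ha0 : ∀ Y, 0 ≤ a Y)
    (haper : ∀ (Y : Config N) (i : Fin N) (k : Fin 3),
      a (Y + Pi.single i (EuclideanSpace.single k L)) = a Y)
    (ha2 : ∫⁻ Y in cellN N L, ‖a Y‖ₑ ^ (2 : ℝ) ≠ ⊤) (X : Config N) :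
    pfkReal v L (s + t) a X = pfkReal v L s (pfkReal v L t a) X := by
  set A : Config N → ℝ≥0∞ := fun Y => ENNReal.ofReal (a Y) with hA
  have hAm : Measurable A := Measurable.ennreal_ofReal ha
  have hAper : ∀ (Y : Config N) (i : Fin N) (k : Fin 3),
      A (Y + Pi.single i (EuclideanSpace.single k L)) = A Y := fun Y i k => by
    simp only [hA, haper]
  have hA2 : ∫⁻ Y in cellN N L, A Y ^ (2 : ℝ) ≠ ⊤ := by
    convert ha2 using 1
    refine lintegral_congr fun Y => ?_
    rw [hA, Real.enorm_of_nonneg (ha0 Y)]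
  have hfin : ∀ Y, periodicFKSemigroup v L t A Y ≠ ⊤ := fun Y =>
    (periodicFKSemigroup_lt_top_of_cell v hL ht hAm hAper hA2 Y).ne
  -- the transform of `pfkReal t a`, a nonnegative measurable function
  have hm : Measurable (pfkReal v L t a) := measurable_pfkReal hv L t ha
  have h0 : ∀ Y, 0 ≤ pfkReal v L t a Y := fun Y => pfkReal_nonneg v L t ha0 Y
  rw [pfkReal_eq_toReal_periodicFKSemigroup hv L s hm h0,
    pfkReal_eq_toReal_periodicFKSemigroup hv L (s + t) ha ha0,
    periodicFKSemigroup_add hv L hs.le ht.le hAm]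
  congr 1
  refine lintegral_congr fun ω => ?_
  congr 1
  dsimp only
  rw [pfkReal_eq_toReal_periodicFKSemigroup hv L t ha ha0, ENNReal.ofReal_toReal (hfin _)]

/-- **Subtractivity** of the real functional on periodic `L²(cell)` observables (`t > 0`).
[folklore] -/
theorem pfkReal_sub {v : ℝ → ℝ≥0∞} (hv : Measurable v) {L : ℝ} (hL : 0 < L) {t : ℝ} (ht : 0 < t)
    {f g : Config N → ℝ} (hf : Measurable f) (hg : Measurable g)
    (hfper : ∀ (Y : Config N) (i : Fin N) (k : Fin 3),
      f (Y + Pi.single i (EuclideanSpace.single k L)) = f Y)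
    (hgper : ∀ (Y : Config N) (i : Fin N) (k : Fin 3),
      g (Y + Pi.single i (EuclideanSpace.single k L)) = g Y)
    (hf2 : ∫⁻ Y in cellN N L, ‖f Y‖ₑ ^ (2 : ℝ) ≠ ⊤) (hg2 : ∫⁻ Y in cellN N L, ‖g Y‖ₑ ^ (2 : ℝ) ≠ ⊤)
    (X : Config N) : pfkReal v L t (f - g) X = pfkReal v L t f X - pfkReal v L t g X := by
  rw [sub_eq_add_neg, pfkReal_add hv hL ht hf hg.neg hfper
    (fun Y i k => by simp only [Pi.neg_apply, hgper]) hf2 (by simpa using hg2) X,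
    show -g = (-1 : ℝ) • g by simp, pfkReal_smul]
  ring

/-- **The semigroup law `e^{-(s+t)H} f = e^{-sH} (e^{-tH} f)` for real periodic `f ∈ L²(cell)`**
(`s, t > 0`; positive and negative parts). [folklore] -/
theorem pfkReal_add_time {v : ℝ → ℝ≥0∞} (hv : Measurable v) {L : ℝ} (hL : 0 < L) {s t : ℝ}
    (hs : 0 < s) (ht : 0 < t) {f : Config N → ℝ} (hf : Measurable f)
    (hfper : ∀ (Y : Config N) (i : Fin N) (k : Fin 3),
      f (Y + Pi.single i (EuclideanSpace.single k L)) = f Y)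
    (hf2 : ∫⁻ Y in cellN N L, ‖f Y‖ₑ ^ (2 : ℝ) ≠ ⊤) (X : Config N) :
    pfkReal v L (s + t) f X = pfkReal v L s (pfkReal v L t f) X := by
  have mfp : Measurable fun Y => max (f Y) 0 := hf.max measurable_const
  have mfn : Measurable fun Y => max (-f Y) 0 := hf.neg.max measurable_const
  have pfp : ∀ (Y : Config N) (i : Fin N) (k : Fin 3),
      max (f (Y + Pi.single i (EuclideanSpace.single k L))) 0 = max (f Y) 0 := posPart_periodic hfper
  have pfn : ∀ (Y : Config N) (i : Fin N) (k : Fin 3),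
      max (-f (Y + Pi.single i (EuclideanSpace.single k L))) 0 = max (-f Y) 0 :=
    negPart_periodic hfper
  have ifp := setLIntegral_cellN_enorm_posPart_sq_ne_top L hf2
  have ifn := setLIntegral_cellN_enorm_negPart_sq_ne_top L hf2
  have p0 : ∀ (h : Config N → ℝ) (Y : Config N), 0 ≤ max (h Y) 0 := fun h Y => le_max_right _ _
  -- `pfkReal t f = pfkReal t f⁺ - pfkReal t f⁻`, both summands periodic and in `L²(cell)`
  have hdec : pfkReal v L t f = pfkReal v L t (fun Y => max (f Y) 0) -
      pfkReal v L t (fun Y => max (-f Y) 0) :=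
    funext fun Y => pfkReal_eq_posPart_sub_negPart hv hL ht hf hfper hf2 Y
  have i1 : ∫⁻ Y in cellN N L, ‖pfkReal v L t (fun Y => max (f Y) 0) Y‖ₑ ^ (2 : ℝ) ≠ ⊤ :=
    ne_top_of_le_ne_top ifp (setLIntegral_cellN_enorm_pfkReal_sq_le hv hL t mfp pfp)
  have i2 : ∫⁻ Y in cellN N L, ‖pfkReal v L t (fun Y => max (-f Y) 0) Y‖ₑ ^ (2 : ℝ) ≠ ⊤ :=
    ne_top_of_le_ne_top ifn (setLIntegral_cellN_enorm_pfkReal_sq_le hv hL t mfn pfn)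
  rw [pfkReal_eq_posPart_sub_negPart hv hL (add_pos hs ht) hf hfper hf2, hdec,
    pfkReal_sub hv hL hs (measurable_pfkReal hv L t mfp) (measurable_pfkReal hv L t mfn)
      (pfkReal_add_single_of_periodic v L t pfp) (pfkReal_add_single_of_periodic v L t pfn) i1 i2,
    pfkReal_add_time_of_nonneg hv hL hs ht mfp (p0 f) pfp ifp,
    pfkReal_add_time_of_nonneg hv hL hs ht mfn (p0 _) pfn ifn]

/-- **`e^{-(s+t)H} = e^{-sH} ∘ e^{-tH}` as operators on `L²([0,L)^{3N})`** (`s, t > 0`, `L > 0`,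
measurable `v`). Chung–Zhao (1995), §3.2 (semigroup property of (26)).
[cite: ChungZhao1995, §3.2 (26)] -/
theorem pfkL2_add_time {v : ℝ → ℝ≥0∞} (hv : Measurable v) {L : ℝ} (hL : 0 < L) {s t : ℝ}
    (hs : 0 < s) (ht : 0 < t) :
    (pfkL2 v L (s + t) : Lp ℝ 2 (volume.restrict (cellN N L)) →L[ℝ] _) =
      (pfkL2 v L s).comp (pfkL2 v L t) := by
  ext1 g
  rw [ContinuousLinearMap.comp_apply, pfkL2_apply hv hL (add_pos hs ht), pfkL2_apply hv hL hs]
  refine MemLp.toLp_congr _ _ (Eventually.of_forall fun X => ?_)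
  rw [pfkReal_add_time hv hL hs ht ((measurable_coeFn_Lp_cellN g).comp (measurable_cellProj L))
    (comp_cellProj_periodic hL.ne' _) (setLIntegral_cellN_enorm_comp_cellProj_sq_ne_top hL g) X]
  exact (pfkReal_congr_ae v L hs (pfkL2_coeFn_comp_cellProj hv hL ht g) X).symm

/-- Iterating: `e^{-tH} = (e^{-(t/2)H})²`. [folklore] -/
theorem pfkL2_eq_comp_half {v : ℝ → ℝ≥0∞} (hv : Measurable v) {L : ℝ} (hL : 0 < L) {t : ℝ}
    (ht : 0 < t) :
    (pfkL2 v L t : Lp ℝ 2 (volume.restrict (cellN N L)) →L[ℝ] _) =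
      (pfkL2 v L (t / 2)).comp (pfkL2 v L (t / 2)) := by
  rw [← pfkL2_add_time hv hL (half_pos ht) (half_pos ht), add_halves]

/-! ### Positivity on `L²(cell)` -/

/-- **Positivity preservation on `L²(cell)`**: `0 ≤ g ⇒ 0 ≤ e^{-tH} g`. [folklore] -/
theorem pfkL2_nonneg {v : ℝ → ℝ≥0∞} (hv : Measurable v) {L : ℝ} (hL : 0 < L) {t : ℝ} (ht : 0 < t)
    {g : Lp ℝ 2 (volume.restrict (cellN N L))} (hg : 0 ≤ g) : 0 ≤ pfkL2 v L t g := by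
  rw [← Lp.coeFn_nonneg] at hg ⊢
  have hrep : (g : Config N → ℝ) =ᵐ[volume.restrict (cellN N L)] fun Y => max (g Y) 0 := by
    filter_upwards [hg] with Y hY
    exact (max_eq_left hY).symm
  filter_upwards [pfkL2_coeFn hv hL ht g] with X hX
  rw [hX, pfkReal_comp_cellProj_congr_ae v hL ht hrep X]
  exact pfkReal_nonneg v L t (fun Y => le_max_right _ _) X

/-- **`|e^{-tH} g| ≤ e^{-tH} |g|` on `L²(cell)`** (lattice absolute value). [folklore] -/
theorem abs_pfkL2_le {v : ℝ → ℝ≥0∞} (hv : Measurable v) {L : ℝ} (hL : 0 < L) {t : ℝ} (ht : 0 < t)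
    (g : Lp ℝ 2 (volume.restrict (cellN N L))) : |pfkL2 v L t g| ≤ pfkL2 v L t |g| := by
  rw [← Lp.coeFn_le]
  filter_upwards [Lp.coeFn_abs (pfkL2 v L t g), pfkL2_coeFn hv hL ht g, pfkL2_coeFn hv hL ht |g|]
    with X h1 h2 h3
  rw [h1, h2, h3, pfkReal_comp_cellProj_congr_ae v hL ht (Lp.coeFn_abs g) X]
  exact abs_pfkReal_le v L t _ X

/-- **`⟪e^{-tH} g, g⟫ = ‖e^{-(t/2)H} g‖² ≥ 0`**: the semigroup consists of positive operators.
[folklore] -/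
theorem inner_pfkL2_self_eq_norm_sq {v : ℝ → ℝ≥0∞} (hv : Measurable v) {L : ℝ} (hL : 0 < L)
    {t : ℝ} (ht : 0 < t) (g : Lp ℝ 2 (volume.restrict (cellN N L))) :
    ⟪pfkL2 v L t g, g⟫_ℝ = ‖pfkL2 v L (t / 2) g‖ ^ 2 := by
  rw [pfkL2_eq_comp_half hv hL ht, ContinuousLinearMap.comp_apply,
    inner_pfkL2_comm hv hL (half_pos ht), real_inner_self_eq_norm_sq]

/-- `⟪e^{-tH} g, g⟫ ≥ 0`. [folklore] -/
theorem inner_pfkL2_self_nonneg {v : ℝ → ℝ≥0∞} (hv : Measurable v) {L : ℝ} (hL : 0 < L) {t : ℝ}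
    (ht : 0 < t) (g : Lp ℝ 2 (volume.restrict (cellN N L))) : 0 ≤ ⟪pfkL2 v L t g, g⟫_ℝ := by
  rw [inner_pfkL2_self_eq_norm_sq hv hL ht]
  positivity

end Literature.MathematicalPhysics.QuantumManyBody.BoseGas

end
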